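import Summits.ABC.IUTFork.Conditional.FreyLegendreAdmissibleList
import Summits.ABC.IUTFork.Conditional.FreyLegendreP6N3Tiny3
import HarnessLib

/-!
# INHABITED DATUM TYPES `Nonempty (ThetaVolumeDatumAt (ratPoint λ) l)` at 3 Frey–Legendre data of the R-W WINDOW-TABLE, every tabulated `l`

PROOF-ONLY file (D-0012; 0 definitions, 0 `Prop` facts, no instance, no notation) of the abc-iut cell (seat abc-iut-w6-d102, gen 5;
row «C:P6-KERNEL-N3», part 2 instances). For each datum `λ = a/c` below (an abc triple `a + b = c` of plan/rescue/R-W/WINDOW-TABLE.tsv,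
spelled VERBATIM as in the tree's K/M rows) and every tabulated prime `l`, the datum type `Cor22.ThetaVolumeDatumAt (ratPoint λ) l` over
which the «refuted by unconditional theorem» rows quantify is INHABITED — `FreyAdm.nonempty_thetaVolumeDatumAt_triple_list` (p490061:
`UP`, `AdmitsCore`, (P2), (P5) DECIDED in the kernel from the full factorisation of `abc`; the route's proved `ThetaPartII.stub_thetaData`)
fed with part 1's (P6) theorems `<Tag>.condP6_tabulated`. Per datum the kernel checks: `IsABCTriple a b c`; every listed prime factor is
prime (`norm_num`); `(abc)² = ∏ p^(e_p)`; `j(a/c) = 2⁸(cb+a²)³/(abc)²` avoids the four core-exceptional values; and for every `l`: `l` prime,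
`l ≥ 5`, `l ∤ e_p` (odd `p`), `2 ∣ abc ∧ e_2 > 8 ⇒ l ∤ e_2 − 8`, some odd `p₀ ∣ abc` with `p₀ ≠ l`.

Data: λ = 1/301327048 (1 + 3¹⁶7 = 2³11·23·53³; tabulated l = 23) · λ = 343/59392 (7³ + 3¹⁰ = 2¹¹29; tabulated l = 29) · λ = 13·19⁶/(3¹³11²31) (13·19⁶ + 2³⁰5 = 3¹³11²31; tabulated l = 31).

HONEST SCOPE: «inhabited» = our TYPED datum type has an element at `(ratPoint λ, l)` (non-vacuity of the `∀ T` rows); classical arithmetic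
of `ℚ` + elliptic curves over `ℚ` + one application of the route's `stub_thetaData`; nothing about [IUTchIII] Cor. 3.12 or the truth of any
S_H; refuted-as-typed ≠ refuted-in-print; no side taken on any author; typed ≠ proved; no abc claim.
[cite: Mochizuki2012, IUTchIV Cor. 2.2 (ii) proof (P2)(P5)(P6)(P7) p. 43–46] [cite: MochizukiGenEll2010, Def. 3.3 p. 12, Ex. 1.3 (i) p. 5]
[claim: Mochizuki2012, status: disputed] for every IUT sentence quoted.
-/

noncomputable section

open scoped Classical

namespace Summit.ABC.IUTFork.Conditional

open Literature.IUT.LogVolume Literature.IUT.LogVolume.Cor22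
open Literature.NumberTheory.DiophantineGeometry Literature.NumberTheory.DiophantineGeometry.GenEll

/-- **INHABITED datum types at `ratPoint (((1 : ℕ) : ℚ) / (301327048 : ℕ))`** (λ = 1/301327048 (1 + 3¹⁶7 = 2³11·23·53³; tabulated l = 23)): for every one of the 1 listed primes `l`
(`23 ≤ l ≤ 23`), `Nonempty (Cor22.ThetaVolumeDatumAt (ratPoint λ) l)` — `UP`, `AdmitsCore`, (P2), (P5) decided from the factorisation
`abc`: primes `[2, 3, 7, 11, 23, 53]` with `e_p = 2·v_p(abc) = [6, 32, 2, 2, 2, 6]`, and (P6) = `FreyP6T301327048.condP6_tabulated`.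
[cite: Mochizuki2012, IUTchIV Cor. 2.2 (ii) proof (P2)(P5)(P6)(P7) p. 45–46] [claim: Mochizuki2012, status: disputed] -/
theorem FreyP6T301327048.nonempty_thetaVolumeDatumAt_tabulated :
    ∀ l ∈ ([23] : List ℕ),
      Nonempty (Cor22.ThetaVolumeDatumAt (ratPoint (((1 : ℕ) : ℚ) / (301327048 : ℕ))) l) :=
  FreyAdm.nonempty_thetaVolumeDatumAt_triple_list (a := 1) (b := 3 ^ 16 * 7) (c := 301327048)
    (by unfold IsABCTriple; decide +kernel)
    (Il := [2, 3, 7, 11, 23, 53]) (e := fun p => if p = 2 then 6 else if p = 3 then 32 else if p = 7 then 2 else if p = 11 then 2 else if p = 23 then 2 else if p = 53 then 6 else 0)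
    (by intro p hp; fin_cases hp <;> norm_num) (by decide) (by decide +kernel) (by decide +kernel)
    (by unfold Cor22.coreExceptionalJ; decide +kernel)
    [23]
    (by decide +kernel) FreyP6T301327048.condP6_tabulated

/-- **INHABITED datum types at `ratPoint (((343 : ℕ) : ℚ) / (59392 : ℕ))`** (λ = 343/59392 (7³ + 3¹⁰ = 2¹¹29; tabulated l = 29)): for every one of the 1 listed primes `l`
(`29 ≤ l ≤ 29`), `Nonempty (Cor22.ThetaVolumeDatumAt (ratPoint λ) l)` — `UP`, `AdmitsCore`, (P2), (P5) decided from the factorisation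
`abc`: primes `[2, 3, 7, 29]` with `e_p = 2·v_p(abc) = [22, 20, 6, 2]`, and (P6) = `FreyP6T59392.condP6_tabulated`.
[cite: Mochizuki2012, IUTchIV Cor. 2.2 (ii) proof (P2)(P5)(P6)(P7) p. 45–46] [claim: Mochizuki2012, status: disputed] -/
theorem FreyP6T59392.nonempty_thetaVolumeDatumAt_tabulated :
    ∀ l ∈ ([29] : List ℕ),
      Nonempty (Cor22.ThetaVolumeDatumAt (ratPoint (((343 : ℕ) : ℚ) / (59392 : ℕ))) l) :=
  FreyAdm.nonempty_thetaVolumeDatumAt_triple_list (a := 343) (b := 3 ^ 10) (c := 59392)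
    (by unfold IsABCTriple; decide +kernel)
    (Il := [2, 3, 7, 29]) (e := fun p => if p = 2 then 22 else if p = 3 then 20 else if p = 7 then 6 else if p = 29 then 2 else 0)
    (by intro p hp; fin_cases hp <;> norm_num) (by decide) (by decide +kernel) (by decide +kernel)
    (by unfold Cor22.coreExceptionalJ; decide +kernel)
    [29]
    (by decide +kernel) FreyP6T59392.condP6_tabulated

/-- **INHABITED datum types at `ratPoint (((13 * 19 ^ 6 : ℕ) : ℚ) / (3 ^ 13 * 11 ^ 2 * 31 : ℕ))`** (λ = 13·19⁶/(3¹³11²31) (13·19⁶ + 2³⁰5 = 3¹³11²31; tabulated l = 31)): for every one of the 1 listed primes `l`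
(`31 ≤ l ≤ 31`), `Nonempty (Cor22.ThetaVolumeDatumAt (ratPoint λ) l)` — `UP`, `AdmitsCore`, (P2), (P5) decided from the factorisation
`abc`: primes `[2, 3, 5, 11, 13, 19, 31]` with `e_p = 2·v_p(abc) = [60, 26, 2, 4, 2, 12, 2]`, and (P6) = `FreyP6T5980305573.condP6_tabulated`.
[cite: Mochizuki2012, IUTchIV Cor. 2.2 (ii) proof (P2)(P5)(P6)(P7) p. 45–46] [claim: Mochizuki2012, status: disputed] -/
theorem FreyP6T5980305573.nonempty_thetaVolumeDatumAt_tabulated :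
    ∀ l ∈ ([31] : List ℕ),
      Nonempty (Cor22.ThetaVolumeDatumAt (ratPoint (((13 * 19 ^ 6 : ℕ) : ℚ) / (3 ^ 13 * 11 ^ 2 * 31 : ℕ))) l) :=
  FreyAdm.nonempty_thetaVolumeDatumAt_triple_list (a := 13 * 19 ^ 6) (b := 2 ^ 30 * 5) (c := 3 ^ 13 * 11 ^ 2 * 31)
    (by unfold IsABCTriple; decide +kernel)
    (Il := [2, 3, 5, 11, 13, 19, 31]) (e := fun p => if p = 2 then 60 else if p = 3 then 26 else if p = 5 then 2 else if p = 11 then 4 else if p = 13 then 2 else if p = 19 then 12 else if p = 31 then 2 else 0)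
    (by intro p hp; fin_cases hp <;> norm_num) (by decide) (by decide +kernel) (by decide +kernel)
    (by unfold Cor22.coreExceptionalJ; decide +kernel)
    [31]
    (by decide +kernel) FreyP6T5980305573.condP6_tabulated

end Summit.ABC.IUTFork.Conditional

end
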